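import Mathlib
import Summits.Schanuel.Schanuel.Theses.DiophantineDichotomy
import Literature.NumberTheory.Transcendental.QuadraticRelationsLogarithmsWeilHeight
import HarnessLib

/-!
# Vocabulary of line `lw-small-height` for crux `KhovanskiiApproxType` (stmt-Schanuel-6116)

Route `DiophantineDichotomy` (sub-problem `Schanuel/Schanuel`), crux
`Summit.Schanuel.Schanuel.Theses.DiophantineDichotomy.KhovanskiiApproxType` (measure of simultaneous
algebraic approximation `‖γ − θ‖ ≥ exp(−C(dᵃ log H + dᵇ))`, `a < 1/(n−1)`, at every free Khovanskii
point `θ = (s, e^s) ∈ ℂ²ⁿ`, `n ≥ 2`).  This file is the **definitions module** of the checked skeleton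
`Cruxes/KhovanskiiApproxType/Lines/lw-small-height.lean` (planner
`planner-cruxplan-stmt-Schanuel-6116-lw-small-height-0`; `ledger skeleton check` OK, 6 registered
stubs; line lead `prover-line-stmt-Schanuel-6116-lean-0`): it carries, verbatim and sorry-free, the
skeleton's VOCABULARY (`IsFreeKhovanskii`, `ApproxTypeAt`, `mvNatHeight`, `CodimOneMeasure`,
`SlotFloor`, `PrimitiveApproxMeasure`) and the six registered STUB STATEMENTS as named `Prop`s
(`LWSmallHeight m`, `CodimOneTransfer`, `SlotDichotomyTwo`, `NonLWInputsTwo`, `RankThreeUp`), so that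
the stub files `Theorems/DiophantineDichotomyKhovanskiiApproxType<StubName>.lean` (each proving
`theorem <stubName> : <Statement>` by name, `--supports stmt-Schanuel-6116`) and the closing skeleton
share ONE copy of every object.  Nothing in this file is asserted: every `def … : Prop` is a statement
to be proved (by a registered stub) or a predicate; the one `theorem` is the `Iff.rfl` reassembly
`khovanskiiApproxType_iff` (the crux is the pointwise statement over free Khovanskii points).

Currency (as in the crux): `d` bounds the field degree `[ℚ(γ):ℚ]` of the challenger `γ`, `H` the
naive height of non-zero integer polynomials of degree `≤ d` vanishing at its coordinates; distances
in the sup norm of `Fin n ⊕ Fin n → ℂ`.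
-/

noncomputable section

-- `Summit.Schanuel.Schanuel.…` is the mandated summit/sub-problem namespace (single-conjunct summit), hence:
set_option linter.dupNamespace false

open scoped BigOperators

namespace Summit.Schanuel.Schanuel.Cruxes.KhovanskiiApproxType.LwSmallHeight

open Summit.Schanuel.Schanuel.Theses.DiophantineDichotomy (KhovanskiiApproxType)

/-! ## The crux, pointwise (bookkeeping; `khovanskiiApproxType_iff` is `Iff.rfl`) -/

/-- `s ∈ ℂⁿ` is a FREE KHOVANSKII POINT: a non-degenerate zero of a Khovanskii system
`g₁(z, e^z) = ⋯ = gₙ(z, e^z) = 0` over `ℚ` (exponential Jacobian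
`det(∂gᵢ/∂zⱼ + yⱼ ∂gᵢ/∂yⱼ)(s, e^s) ≠ 0`) — verbatim the hypothesis of the crux. -/
def IsFreeKhovanskii (n : ℕ) (s : Fin n → ℂ) : Prop :=
  ∃ g : Fin n → MvPolynomial (Fin n ⊕ Fin n) ℚ,
    (∀ i, MvPolynomial.aeval (Sum.elim s (Complex.exp ∘ s)) (g i) = 0) ∧
    (Matrix.of fun i j => MvPolynomial.aeval (Sum.elim s (Complex.exp ∘ s))
      (MvPolynomial.pderiv (Sum.inl j) (g i) +
        MvPolynomial.X (Sum.inr j) * MvPolynomial.pderiv (Sum.inr j) (g i))).det ≠ 0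

/-- APPROXIMATION TYPE `(a, b, C)` at `θ = (s, e^s) ∈ ℂ²ⁿ` — verbatim the tail of the crux: every
algebraic challenger `γ` with `[ℚ(γ):ℚ] ≤ d` whose coordinates are roots of non-zero integer polynomials
of degree `≤ d` and height `≤ H` satisfies `‖γ − θ‖ ≥ exp(−C(dᵃ log H + dᵇ))` (sup norm). -/
def ApproxTypeAt (n : ℕ) (s : Fin n → ℂ) (a b C : ℝ) : Prop :=
  0 < C ∧ ∀ (d H : ℕ) (γ : Fin n ⊕ Fin n → ℂ),
    Module.finrank ℚ ↥(IntermediateField.adjoin ℚ (Set.range γ)) ≤ d →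
    (∀ i, ∃ P : Polynomial ℤ, P ≠ 0 ∧ P.natDegree ≤ d ∧ (∀ k, |P.coeff k| ≤ (H : ℤ)) ∧
      Polynomial.aeval (γ i) P = 0) →
    Real.exp (-(C * ((d : ℝ) ^ a * Real.log H + (d : ℝ) ^ b))) ≤ ‖γ - Sum.elim s (Complex.exp ∘ s)‖

/-- The crux is, by `Iff.rfl`, the pointwise statement "every free Khovanskii point of `ℂⁿ`, `n ≥ 2`,
with `ℚ`-linearly independent coordinates has approximation type `a < 1/(n−1)`". -/
theorem khovanskiiApproxType_iff :
    KhovanskiiApproxType ↔ ∀ (n : ℕ) (s : Fin n → ℂ), 2 ≤ n → LinearIndependent ℚ s →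
      IsFreeKhovanskii n s → ∃ a b C : ℝ, a < 1 / ((n : ℝ) - 1) ∧ ApproxTypeAt n s a b C :=
  Iff.rfl

/-! ## Native-currency objects: codimension-one measures, floors, primitive approximation measures -/

/-- Naive height of an integer polynomial in several variables: `max |coefficient|` (`0` for `P = 0`). -/
def mvNatHeight {m : ℕ} (P : MvPolynomial (Fin m) ℤ) : ℕ := P.support.sup fun e => (P.coeff e).natAbs

/-- `C⁺` kernel — DECOUPLED CODIMENSION-ONE MEASURE at `ω ∈ ℂᵐ` with degree exponent `μ`, height-free
exponent `K`, constant `C`: `log|P(ω)| ≥ −C((max 1 deg P)^μ · log(max 1 H(P)) + (max 1 deg P)^K)` for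
every non-zero `P ∈ ℤ[X₁,…,X_m]` (total degree, naive height). Dirichlet forces `μ ≥ m`; the shape with
`μ = m` is best possible in the `log H` aspect (Ably 1994 p. 29). It implies that the coordinates of `ω`
are algebraically independent. -/
def CodimOneMeasure (m : ℕ) (ω : Fin m → ℂ) (μ K C : ℝ) : Prop :=
  0 < C ∧ ∀ P : MvPolynomial (Fin m) ℤ, P ≠ 0 →
    Real.exp (-(C * ((max 1 (P.totalDegree : ℝ)) ^ μ * Real.log (max 1 (mvNatHeight P : ℝ)) +
      (max 1 (P.totalDegree : ℝ)) ^ K))) ≤ ‖MvPolynomial.aeval ω P‖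

/-- SLOT FLOOR at `ξ ∈ ℂ` with exponents `(A, K)`: the one-variable codimension-one measure
`log|P(ξ)| ≥ −C((max 1 deg P)^A log(max 1 H(P)) + (max 1 deg P)^K)` (stated over `MvPolynomial (Fin 1) ℤ`
so that `LWSmallHeight 1` delivers it by instantiation). In print: `A = 1 + ε` for `π` (Waldschmidt 1978,
Bugeaud2004 §8.3 p. 183); only `A = 2` decoupled for `e`, `e^β`, `log α`. -/
def SlotFloor (ξ : ℂ) (A K C : ℝ) : Prop :=
  CodimOneMeasure 1 (fun _ : Fin 1 => ξ) A K C

/-- PRIMITIVE APPROXIMATION MEASURE at `ω ∈ ℂᵐ` with exponents `(p, q)`: for every algebraic challenger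
`γ ∈ ℚ̄ᵐ` with `[ℚ(γ):ℚ] ≤ d`, every coordinate of degree `≥ d'` over `ℚ` and a root of a non-zero integer
polynomial of degree `≤ d`, height `≤ H`:  `‖γ − ω‖ ≥ exp(−C(d^p (log H + d)/d' + d^q))`.
The output format of the transfer (`(log H + d)/d'` bounds the Weil heights `h(γ_j)`). -/
def PrimitiveApproxMeasure (m : ℕ) (ω : Fin m → ℂ) (p q C : ℝ) : Prop :=
  0 < C ∧ ∀ (d d' H : ℕ) (γ : Fin m → ℂ), 1 ≤ d' →
    Module.finrank ℚ ↥(IntermediateField.adjoin ℚ (Set.range γ)) ≤ d →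
    (∀ i, d' ≤ (minpoly ℚ (γ i)).natDegree) →
    (∀ i, ∃ P : Polynomial ℤ, P ≠ 0 ∧ P.natDegree ≤ d ∧ (∀ k, |P.coeff k| ≤ (H : ℤ)) ∧
      Polynomial.aeval (γ i) P = 0) →
    Real.exp (-(C * ((d : ℝ) ^ p * (Real.log H + d) / d' + (d : ℝ) ^ q))) ≤ ‖γ - ω‖

/-! ## The six stub statements -/

/-- `LWSmallHeight m` — SMALL-HEIGHT LINDEMANN–WEIERSTRASS in `m` variables (the idea card's target):
for algebraic, `ℚ`-linearly independent `y₁, …, y_m`, the point `(e^{y₁}, …, e^{y_m})` carries a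
decoupled codimension-one measure with the Dirichlet-optimal degree exponent `μ = m` and a POLYNOMIAL
height-free penalty `(deg P)^K`, valid for ALL heights:
`log|P(e^{y₁},…,e^{y_m})| ≥ −C((deg P)^m log H(P) + (deg P)^K)`.
Printed: Ably 1994 (Acta Arith. 67, Thm p. 30) `−c₂Dᵐ(log H + exp(C Dᵐ log(D+1)))` (exponential
penalty), Nesterenko 1977 (`log log H > C D^{2m} log(D+1)`), Mahler 1932 (`H ≥ H₀(D)`), Sert 1999 (JNT 76,
not yet read: acq-04524 — the card's cheapest falsifier). Registered stubs `stub_lwSmallHeight_one`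
(`m = 1`) and `stub_lwSmallHeight_two` (`m = 2`); both OPEN. -/
def LWSmallHeight (m : ℕ) : Prop :=
  ∀ y : Fin m → ℂ, (∀ i, IsAlgebraic ℚ (y i)) → LinearIndependent ℚ y →
    ∃ K C : ℝ, 0 ≤ K ∧ CodimOneMeasure m (Complex.exp ∘ y) (m : ℝ) K C

/-- `CodimOneTransfer` — SIEGEL INSIDE THE IDEAL OF THE CHALLENGER (companion card's first lemma,
provable now; registered stub `stub_codimOneTransfer`): a decoupled codimension-one measure with
exponents `(μ, K)` at `ω ∈ ℂᵐ` gives the primitive approximation measure with `p = (μ+1)/m`,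
`q = (max μ K + 1)/m + 1`. Proof sketch: for a challenger `γ` take the least `δ` with
`C(δ+m, m) ≥ 2d` (`δ ≤ c_m d^{1/m}`) and a non-zero `Q ∈ ℤ[X]`, `deg Q ≤ δ`, `Q(γ) = 0`,
`h(Q) ≤ δ m·max_j h(γ_j) + O(log d)` (absolute Siegel lemma over `ℚ` for one equation over `ℚ(γ)`:
box principle in one complex embedding + the Liouville inequality `log|β| ≥ −[ℚ(γ):ℚ]·h(β)`; no
discriminant), `h(γ_j) ≤ (log H + log(d+1))/deg γ_j` (Mahler measure of a factor), then
`|Q(ω)| ≤ ‖∇Q‖·‖ω − γ‖` against `C⁺` applied to `Q`. -/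
def CodimOneTransfer : Prop :=
  ∀ (m : ℕ) (ω : Fin m → ℂ) (μ K C : ℝ), 1 ≤ m → 0 ≤ μ → 0 ≤ K → CodimOneMeasure m ω μ K C →
    ∃ C' : ℝ, PrimitiveApproxMeasure m ω ((μ + 1) / m) ((max μ K + 1) / m + 1) C'

/-- `SlotDichotomyTwo` — the `n = 2` COMPOSITION (provable now; registered stub
`stub_slotDichotomy_two`): at `θ = (s, e^s) ∈ ℂ⁴`, a primitive approximation measure with exponents
`(p, q)` at a pair `θ ∘ e` of coordinates plus floors with degree exponent `A` at both coordinates of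
the pair give approximation type `a = A·p/(A+1) < 1` provided `A·p < A + 1`. Proof sketch: challenger
`γ` with budget `(d, H)`; `d'` = least degree of `γ (e i)`; if `d' ≥ d^τ` use the measure on the pair
(`‖γ − θ‖ ≥ ‖γ ∘ e − θ ∘ e‖`); else apply the floor at the small slot to the minimal polynomial `f` of
`γ (e i)` (`deg f = d'`, `log H(f) ≤ log H + 2d` by Mahler/Mignotte,
`|f(θ_j)| ≤ d'² H(f)(|θ_j| + 2)^{d'}|θ_j − γ_j|`); take `τ = p/(A+1)`. -/
def SlotDichotomyTwo : Prop :=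
  ∀ (s : Fin 2 → ℂ) (e : Fin 2 → Fin 2 ⊕ Fin 2) (p q C A : ℝ), Function.Injective e →
    0 ≤ p → 0 < A → A * p < A + 1 →
    PrimitiveApproxMeasure 2 (Sum.elim s (Complex.exp ∘ s) ∘ e) p q C →
    (∀ i, ∃ K₁ C₁ : ℝ, SlotFloor (Sum.elim s (Complex.exp ∘ s) (e i)) A K₁ C₁) →
    ∃ a b C' : ℝ, a < 1 ∧ ApproxTypeAt 2 s a b C'

/-- `NonLWInputsTwo` — the INPUTS at the non-Lindemann–Weierstrass `n = 2` points (companion card's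
kernel `C⁺` restricted to `n = 2`, plus floors; registered stub `stub_nonLWInputs_two`, OPEN and
Schanuel-strength pointwise): at every free Khovanskii point `s ∈ ℂ²` with a transcendental coordinate
there is a pair `e` of coordinates of `θ = (s, e^s)` carrying a decoupled codimension-one measure with
exponent `μ` and floors with exponent `A` at both, in the race window `A(μ+1) < 2(A+1)`
(`μ = 2 ⇒ A < 2`; `A = 1 ⇒ μ < 3`). At `s = (1, iπ)`, `θ = (1, iπ, e, −1)`, the pair is `(iπ, e)` and
`C⁺` contains `e ⊥ π` (as the crux there must, by the route's `EPiRace`); the floors are Waldschmidt 1978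
for `π` (`A = 1+ε`, in print) and `LWSmallHeight 1` at `β = 1` for `e`. Other species: `(1, log 2)`,
`(log 2, log 3)` (`AlgebraicIndependenceOfLogarithms` barrier conceded; log-floors have only `A = 2` in
print), `(iπ, π)` (Nesterenko point: `trdeg = 2` known, codimension-one measure in print in the size
currency, NP2001 Ch. 3 Cor. 5.2), implicit fixed-point systems. -/
def NonLWInputsTwo : Prop :=
  ∀ s : Fin 2 → ℂ, LinearIndependent ℚ s → IsFreeKhovanskii 2 s → (∃ i, Transcendental ℚ (s i)) →
    ∃ e : Fin 2 → Fin 2 ⊕ Fin 2, Function.Injective e ∧ ∃ μ K C A : ℝ,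
      0 ≤ μ ∧ 0 ≤ K ∧ 0 < A ∧ A * (μ + 1) < 2 * (A + 1) ∧
      CodimOneMeasure 2 (Sum.elim s (Complex.exp ∘ s) ∘ e) μ K C ∧
      ∀ i, ∃ K₁ C₁ : ℝ, SlotFloor (Sum.elim s (Complex.exp ∘ s) (e i)) A K₁ C₁

/-- `RankThreeUp` — the RESIDUAL: the crux at free Khovanskii points of `ℂⁿ`, `n ≥ 3` (registered
stub `stub_rankThreeUp`; OPEN, crux-sized: it IS the crux for `n ≥ 3`). NOT attacked by this line
(architecture cap `a = (n+1)/(2n) ≥ 1/(n−1)` for `n ≥ 3`, triage W.lean); carried so that the skeleton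
concludes the `∀ n ≥ 2` crux by name. -/
def RankThreeUp : Prop :=
  ∀ (n : ℕ) (s : Fin n → ℂ), 3 ≤ n → LinearIndependent ℚ s → IsFreeKhovanskii n s →
    ∃ a b C : ℝ, a < 1 / ((n : ℝ) - 1) ∧ ApproxTypeAt n s a b C

end Summit.Schanuel.Schanuel.Cruxes.KhovanskiiApproxType.LwSmallHeight

end

/-! ## Reshaped stub 3 (line lead `prover-line-stmt-Schanuel-6116-r-0`, 2026-08-16): Siegel's lemma
inside the ideal of the challenger, split off `CodimOneTransfer`

The registered stub `stub_codimOneTransfer : CodimOneTransfer` is reshaped at the skeleton level into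
`stub_siegelInIdeal : SiegelInIdeal` (the arithmetic input: a SMALL integer relation of low degree
among the coordinates of an algebraic point, by the box principle in one complex embedding plus the
archimedean Liouville inequality — no discriminant, no norm) and
`stub_transferOfSiegel : SiegelInIdeal → CodimOneTransfer` (mean value theorem + Mahler-measure
bookkeeping).  Heights: `weilHeight₁ F` is the tree's absolute logarithmic Weil height of a complex
number lying in the number field `F ⊂ ℂ`
(`Literature.NumberTheory.Transcendental.QuadraticRelationsLogarithmsWeilHeight`; for a root `α` of an
irreducible `P ∈ ℤ[X]`, `weilHeight₁ F α = log M(P) / deg P`, tree lemma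
`RoyWaldschmidt1997.MahlerWeil.weilHeight₁_root_eq`). -/

noncomputable section

set_option linter.dupNamespace false

namespace Summit.Schanuel.Schanuel.Cruxes.KhovanskiiApproxType.LwSmallHeight

open Literature.NumberTheory.Transcendental (weilHeight₁)

/-- SIEGEL'S LEMMA INSIDE THE IDEAL OF THE CHALLENGER, shape `(A, B, E)` in `m` variables, over the
BOX of monomials `X^e`, `eᵢ ≤ t` (`N = (t+1)^m` of them): for every number field `F ⊂ ℂ`
(`D = [F:ℚ]`), every point `γ ∈ Fᵐ` and every `t` with `A·(D+1) ≤ (t+1)^m` there is a non-zero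
`Q ∈ ℤ[X₁,…,X_m]` supported on that box with `Q(γ) = 0` and naive height
`H(Q) ≤ B · (t+1)^E · exp(E · t · Σⱼ h(γⱼ))`, `h` = absolute logarithmic Weil height (`weilHeight₁ F`).
Expected constants: `A = 4` (`N ≥ 4(D+1)` unknowns against one linear condition over `F`, i.e. two
real conditions per complex box-principle step), `B = 6`, `E = max m 2`. -/
def SiegelInIdealShape (m : ℕ) (A B E : ℝ) : Prop :=
  ∀ (F : IntermediateField ℚ ℂ) [FiniteDimensional ℚ F] (γ : Fin m → ℂ), (∀ j, γ j ∈ F) →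
    ∀ t : ℕ, A * ((Module.finrank ℚ F : ℝ) + 1) ≤ ((t : ℝ) + 1) ^ m →
      ∃ Q : MvPolynomial (Fin m) ℤ, Q ≠ 0 ∧ (∀ e ∈ Q.support, ∀ i, e i ≤ t) ∧
        MvPolynomial.aeval γ Q = 0 ∧
        (mvNatHeight Q : ℝ) ≤ B * ((t : ℝ) + 1) ^ E *
          Real.exp (E * t * ∑ j, weilHeight₁ F (fun _ : Unit => γ j))

/-- `SiegelInIdeal` — the relative Siegel lemma (rational-integer solutions of ONE linear equation
with coefficients in a number field `F ⊂ ℂ`, Bombieri–Vaaler / Bombieri–Gubler Thm 2.9.19 with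
`K = ℚ`, `M = 1`, in the weak form the transfer needs: exponent `1` on `exp(t·Σh)` up to the constant
`E`, polynomial loss in `N`) holds in every number of variables `m ≥ 1` with SOME shape `(A, B, E)`.
Registered stub `stub_siegelInIdeal`; provable now (box principle + Liouville inequality
`Literature.NumberTheory.DiophantineGeometry.neg_logHeight₁_le_log_norm_complexEmbedding`). -/
def SiegelInIdeal : Prop :=
  ∀ m : ℕ, 1 ≤ m → ∃ A B E : ℝ, 0 < A ∧ 0 < B ∧ 0 ≤ E ∧ SiegelInIdealShape m A B E

end Summit.Schanuel.Schanuel.Cruxes.KhovanskiiApproxType.LwSmallHeight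

end

/-! ## Vocabulary of line `height-window-compactness` (line lead `prover-line-stmt-Schanuel-6116-0`,
2026-08-16): the Ably penalty class and the five new stub statements

The picked line `height-window-compactness` (checked skeleton
`Cruxes/KhovanskiiApproxType/Lines/height_window_compactness.lean`, planner
`planner-cruxplan-stmt-Schanuel-6116-height-window-compac-0`; 7 registered stubs) cuts the
Lindemann–Weierstrass layer of the typed crux by HEIGHT WINDOWS.  Its native objects are the objects
above (`CodimOneMeasure`, `SlotFloor`, `PrimitiveApproxMeasure`, `ApproxTypeAt`) with the POLYNOMIAL
height-free penalty `(max 1 deg)^K` replaced by the penalty CLASS of the printed all-heights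
Lindemann–Weierstrass measures (Ably 1994, Acta Arith. 67, Théorème p. 30:
`log|P(e^{y})| ≥ −c₂Dᵐ(log H + exp(C Dᵐ log(D+1)))`): `exp(κ Dᵐ log(D+2))` at the codimension-one
level in `m` variables and `exp(κ d log(d+2))` at the level of challengers of degree `≤ d` (the class
is stable under the transfer: the auxiliary relation has degree `Δ` with `Δᵐ = O(d)`).  As above,
nothing here is asserted: every `def … : Prop` is a registered stub statement (`LWPenaltyMeasure`,
`CodimOneTransferX`, `SlotDichotomyXTwo`, `ExpFiniteType`, `LWWindowTwo`; the two remaining stubs of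
the line are `NonLWInputsTwo` and `RankThreeUp` above, unchanged) or a predicate, carried verbatim
from the checked skeleton so that the stub files
`Theorems/DiophantineDichotomyKhovanskiiApproxType<StubName>.lean` and the closing skeleton share ONE
copy of every object. -/

noncomputable section

set_option linter.dupNamespace false

namespace Summit.Schanuel.Schanuel.Cruxes.KhovanskiiApproxType.HeightWindowCompactness

open Summit.Schanuel.Schanuel.Cruxes.KhovanskiiApproxType.LwSmallHeight
open Polynomial

/-! ### The Ably penalty class -/

/-- Codimension-one measure at `ω ∈ ℂᵐ` in the ABLY PENALTY CLASS: degree exponent `μ` on the height,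
height-free penalty `exp(κ Dᵐ log(D+2))`, `D = max 1 (deg P)`, `H = max 1 (height P)`:
`log|P(ω)| ≥ −(C D^μ log H + exp(κ Dᵐ log(D+2)))` for every non-zero `P ∈ ℤ[X₁,…,X_m]`
(total degree, naive height `mvNatHeight`). -/
def CodimOneMeasureX (m : ℕ) (ω : Fin m → ℂ) (μ κ C : ℝ) : Prop :=
  0 < C ∧ ∀ P : MvPolynomial (Fin m) ℤ, P ≠ 0 →
    Real.exp (-(C * (max 1 (P.totalDegree : ℝ)) ^ μ * Real.log (max 1 (mvNatHeight P : ℝ)) +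
        Real.exp (κ * (max 1 (P.totalDegree : ℝ)) ^ m * Real.log (max 1 (P.totalDegree : ℝ) + 2)))) ≤
      ‖MvPolynomial.aeval ω P‖

/-- One-variable floor at `ξ` in the Ably penalty class (`m = 1`: penalty `exp(κ D log(D+2))`). -/
def SlotFloorX (ξ : ℂ) (A κ C : ℝ) : Prop :=
  CodimOneMeasureX 1 (fun _ : Fin 1 => ξ) A κ C

/-- Primitive approximation measure at `ω ∈ ℂᵐ` in the penalty class `exp(κ d log(d+2))`: for every
algebraic challenger `γ` with `[ℚ(γ):ℚ] ≤ d`, all coordinates of degree `≥ d'` over `ℚ` and roots of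
non-zero integer polynomials of degree `≤ d`, height `≤ H`:
`‖γ − ω‖ ≥ exp(−(C d^p (log H + d)/d' + exp(κ d log(d+2))))`. -/
def PrimitiveApproxMeasureX (m : ℕ) (ω : Fin m → ℂ) (p κ C : ℝ) : Prop :=
  0 < C ∧ ∀ (d d' H : ℕ) (γ : Fin m → ℂ), 1 ≤ d' →
    Module.finrank ℚ ↥(IntermediateField.adjoin ℚ (Set.range γ)) ≤ d →
    (∀ i, d' ≤ (minpoly ℚ (γ i)).natDegree) →
    (∀ i, ∃ P : Polynomial ℤ, P ≠ 0 ∧ P.natDegree ≤ d ∧ (∀ k, |P.coeff k| ≤ (H : ℤ)) ∧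
      Polynomial.aeval (γ i) P = 0) →
    Real.exp (-(C * (d : ℝ) ^ p * (Real.log H + d) / d' +
        Real.exp (κ * d * Real.log ((d : ℝ) + 2)))) ≤ ‖γ - ω‖

/-- PENALTY FORM of the crux's conclusion at `θ = (s, e^s)`: degree exponent `a` on `log H`, penalty
`exp(κ d log(d+2))` in place of `C dᵇ`; all heights.  Above `H ≥ exp(exp(κ d log(d+2)))` it is the
typed bound (skeleton lemma `typed_above_of_pen`); it implies the EVENTUAL-in-`H` form of the typed
bound consumed by the route's race. -/
def ApproxTypePenAt (n : ℕ) (s : Fin n → ℂ) (a κ C : ℝ) : Prop :=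
  0 < C ∧ ∀ (d H : ℕ) (γ : Fin n ⊕ Fin n → ℂ),
    Module.finrank ℚ ↥(IntermediateField.adjoin ℚ (Set.range γ)) ≤ d →
    (∀ i, ∃ P : Polynomial ℤ, P ≠ 0 ∧ P.natDegree ≤ d ∧ (∀ k, |P.coeff k| ≤ (H : ℤ)) ∧
      Polynomial.aeval (γ i) P = 0) →
    Real.exp (-(C * (d : ℝ) ^ a * Real.log H + Real.exp (κ * d * Real.log ((d : ℝ) + 2)))) ≤
      ‖γ - Sum.elim s (Complex.exp ∘ s)‖

/-! ### The five new stub statements -/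

/-- STUB 1 statement — `LWPenaltyMeasure` (PRINTED: Ably 1994, Acta Arith. 67, Théorème p. 30, for
every `m ≥ 1`; Mahler 1932 / Nesterenko 1977 give the same eventually in `H`): at
`(e^{y₁},…,e^{y_m})`, `y ∈ ℚ̄ᵐ` `ℚ`-linearly independent, a codimension-one measure with the
Dirichlet-optimal degree exponent `μ = m` and an Ably-class penalty:
`log|P(e^{y})| ≥ −(C Dᵐ log H + exp(κ Dᵐ log(D+2)))` for ALL non-zero `P ∈ ℤ[X]`
(`c₂Dᵐ·exp(CDᵐlog(D+1)) ≤ exp((C + log c₂ + m) Dᵐ log(D+2))`).  Used at `m = 2` (the `C⁺` input of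
the transfer) and `m = 1` (the floors `A = 1`).  Registered stub `stub_lwPenaltyMeasure`. -/
def LWPenaltyMeasure : Prop :=
  ∀ (m : ℕ) (y : Fin m → ℂ), 1 ≤ m → (∀ i, IsAlgebraic ℚ (y i)) → LinearIndependent ℚ y →
    ∃ κ C : ℝ, CodimOneMeasureX m (Complex.exp ∘ y) m κ C

/-- STUB 2 statement — `CodimOneTransferX` (provable now: the landed `stub_transferOfSiegel`, p76504,
re-run with the Ably penalty class; `stub_siegelInIdeal`, p76390, is reused unchanged): a
codimension-one measure `(μ, κ, C)` at `ω ∈ ℂᵐ` gives the primitive approximation measure with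
`p = (μ+1)/m` in the class `exp(κ' d log(d+2))` — the auxiliary relation `Q` has degree
`Δ ≤ m(t+1)`, `(t+1)ᵐ ≤ (c₁+1)ᵐ d`, so `exp(κ Δᵐ log(Δ+2)) ≤ exp(κ' d log(d+2))`, and the polynomial
losses `d^q` of the landed bookkeeping are absorbed into the same class.  Registered stub
`stub_penaltyTransfer`. -/
def CodimOneTransferX : Prop :=
  ∀ (m : ℕ) (ω : Fin m → ℂ) (μ κ C : ℝ), 1 ≤ m → 0 ≤ μ → CodimOneMeasureX m ω μ κ C →
    ∃ κ' C' : ℝ, PrimitiveApproxMeasureX m ω ((μ + 1) / m) κ' C'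

/-- STUB 3 statement — `SlotDichotomyXTwo` (provable now: the landed `stub_slotDichotomy_two`, p75181,
re-run with the Ably penalty class): at `θ = (s, e^s) ∈ ℂ⁴`, a primitive approximation measure with
exponent `p` at a pair `θ ∘ e` of coordinates plus floors with degree exponent `A` at both, all in
the penalty class, give the PENALTY FORM of the crux with `a = A·p/(A+1) < 1` provided `A·p < A + 1`
(slot dichotomy at `d^τ`, `τ = p/(A+1)`; the floor branch uses `slot_repulsion`'s proof with the
penalty `exp(κ₁ d' log(d'+2)) ≤ exp(κ₁⁺ d log(d+2))`, `d' ≤ d`).  Registered stub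
`stub_penaltySlotDichotomy_two`. -/
def SlotDichotomyXTwo : Prop :=
  ∀ (s : Fin 2 → ℂ) (e : Fin 2 → Fin 2 ⊕ Fin 2) (p κ C A : ℝ), Function.Injective e →
    0 ≤ p → 0 < A → A * p < A + 1 →
    PrimitiveApproxMeasureX 2 (Sum.elim s (Complex.exp ∘ s) ∘ e) p κ C →
    (∀ i, ∃ κ₁ C₁ : ℝ, SlotFloorX (Sum.elim s (Complex.exp ∘ s) (e i)) A κ₁ C₁) →
    ∃ a κ' C' : ℝ, a < 1 ∧ ApproxTypePenAt 2 s a κ' C'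

/-- LANG'S TYPE OF TRANSCENDENCE (Chudnovsky 1984, Introduction, Definition 2, p. 25): `ξ` has type
`≤ τ` with constant `C` if `|P(ξ)| ≥ exp(−C (d(P) + log H(P))^τ)` for every non-zero `P ∈ ℤ[X]`;
written with upper bounds `N ≥ max(1, deg P)`, `B ≥ max(1, |coefficients|)` (monotone in both, so
equivalent up to the constant).  A predicate (parameters `ξ, τ, C`), not a statement. -/
def HasTranscendenceType (ξ : ℂ) (τ C : ℝ) : Prop :=
  0 < C ∧ ∀ (P : ℤ[X]) (N : ℕ) (B : ℝ), P ≠ 0 → 1 ≤ N → P.natDegree ≤ N → 1 ≤ B →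
    (∀ k, |(P.coeff k : ℝ)| ≤ B) → Real.exp (-(C * ((N : ℝ) + Real.log B) ^ τ)) ≤ ‖aeval ξ P‖

/-- STUB 4 statement — `ExpFiniteType` (PRINTED: for `β ∈ ℚ̄*`, `e^β` has FINITE type of
transcendence — `≤ 3 + ε`, Chudnovsky 1984 Introduction p. 26 (after Cijsouw 1972 and Waldschmidt
1978, *Transcendence measures for exponentials and logarithms*, J. Austral. Math. Soc. 25, Cor. 4.2);
`τ ≥ 2` is forced by Dirichlet).  ANY finite `τ` suffices for the line: the stub is used only BELOW
`H < exp(d^{b₀})`, where `(d + log H)^τ ≤ (4 d^{max(b₀,1)})^τ` is a pure power of `d`.  Registered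
stub `stub_expFiniteType`. -/
def ExpFiniteType : Prop :=
  ∀ β : ℂ, IsAlgebraic ℚ β → β ≠ 0 → ∃ τ C : ℝ, HasTranscendenceType (Complex.exp β) τ C

/-- STUB 5 statement — `LWWindowTwo` (OPEN — the line's research residue, = `LWSmallHeight 1 ∧ 2`
restricted to ONE height window, skeleton lemma `lwWindowTwo_of_lwSmallHeight`): at a
Lindemann–Weierstrass point `s ∈ ℚ̄²` (lin. independent) and for every `κ`, the typed bound with some
`a < 1` holds for the challengers whose height lies in the window
`exp(d^{b₀}) ≤ H < exp(exp(κ d log(d+2)))`, for some `b₀` of the prover's choosing (larger `b₀` =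
smaller window; the floor below `exp(d^{b₀})` costs only a larger `b`).  Nothing is in print inside
the window: Ably's penalty there is `exp(C d log d) ≫ C d^{3/4} log H`.  Registered stub
`stub_lwWindow_two`. -/
def LWWindowTwo : Prop :=
  ∀ s : Fin 2 → ℂ, (∀ i, IsAlgebraic ℚ (s i)) → LinearIndependent ℚ s → ∀ κ : ℝ,
    ∃ b₀ a b C : ℝ, a < 1 ∧ 0 < C ∧ ∀ (d H : ℕ) (γ : Fin 2 ⊕ Fin 2 → ℂ),
      Real.exp ((d : ℝ) ^ b₀) ≤ (H : ℝ) →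
      (H : ℝ) < Real.exp (Real.exp (κ * d * Real.log ((d : ℝ) + 2))) →
      Module.finrank ℚ ↥(IntermediateField.adjoin ℚ (Set.range γ)) ≤ d →
      (∀ i, ∃ P : Polynomial ℤ, P ≠ 0 ∧ P.natDegree ≤ d ∧ (∀ k, |P.coeff k| ≤ (H : ℤ)) ∧
        Polynomial.aeval (γ i) P = 0) →
      Real.exp (-(C * ((d : ℝ) ^ a * Real.log H + (d : ℝ) ^ b))) ≤
        ‖γ - Sum.elim s (Complex.exp ∘ s)‖

end Summit.Schanuel.Schanuel.Cruxes.KhovanskiiApproxType.HeightWindowCompactness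

end
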